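import Mathlib.Analysis.SpecialFunctions.SmoothTransition
import Mathlib.Analysis.SpecialFunctions.Integrals.Basic
import Mathlib.MeasureTheory.Integral.IntervalIntegral.FundThmCalculus
import Mathlib.Analysis.Calculus.ContDiff.Deriv
import Mathlib.Analysis.Calculus.Deriv.Slope
import HarnessLib

/-!
# The profile `λ` of the boundary-adapted height function `G = 1 + λ(-F) · (⟪a, ·⟫ - c₁)`
(topic `Literature/Geometry/Riemannian`; one-variable analysis for the discharge of the named
fact `Literature.Geometry.Riemannian.Sha1986_homotopyEquiv_cwComplex_of_pConvex` of
`PConvexDomainHomotopyType.lean` — Sha 1986, Thm. 1, flat case; companion of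
`BoundaryAdaptedHessian.lean`, whose module docstring describes the road: the interior Morse
theory of the tree is applied to a boundary-adapted generic height function on the compact
domain `Ω = {F ≤ 0} ⊂ ℝⁿ⁺¹` with `p`-convex boundary)

For a smooth `λ : ℝ → ℝ` and `G(x) = 1 + λ(-F(x)) · k(x)` with `k = ⟪a, ·⟫ - c₁ < 0` near `Ω`:

* `λ(0) = 0`, `λ'(0) > 0`, `λ < 0` on `(-∞, 0)`, `λ > 0` on `(0, ∞)` give `{G ≤ 1} = {F ≤ 0}`,
  `{G = 1} = {F = 0}` and `DG = -k λ'(0) DF ≠ 0` on `{F = 0}` (a regular top level, as for the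
  tree's adapted Morse functions `Literature.Topology.FourManifolds.IsMorseAdapted`);
* `DG = -k λ'(-F) DF + λ(-F) ⟪a, ·⟫`, so (`λ' ≥ 0`) at a critical point `x` of depth
  `s = -F(x) > 0` one has `λ'(s) > 0` and `a = (k λ'/λ)(s) ∇F(x)` antiparallel to `∇F(x)`, and
  `λ' = 0` on `[σ, ∞)` confines the critical points to the collar `{0 < -F < σ}`;
* there `D²G(x) = -k [λ' D²F(x) + (2λ'²/λ - λ'') DF(x) ⊗ DF(x)]`, a form `κ D + N DF ⊗ DF` with
  `κ = -k λ' > 0` and `N / κ = (2λ'²/λ - λ'')/λ'`; the index bound and the nondegeneracy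
  criterion of `BoundaryAdaptedHessian.lean` need `N ‖∇F‖² / κ` larger than constants of `F`,
  which the inequality `λ λ' ≤ s (2λ'² - λ λ'')` (i.e. `N/κ ≥ 1/s ≥ 1/σ`) provides for `σ` small.

`exists_boundaryProfile` constructs such a `λ` for every `σ > 0` (linear up to `σ/2`, then
`exp` of a primitive of `φ(v)/v` for a smooth decreasing plateau `φ`; Mathlib's
`Real.smoothTransition`, the fundamental theorem of calculus `integral_hasDerivAt_right`,
`integral_inv_of_pos`, `contDiffOn_infty_iff_deriv_of_isOpen`).  Everything is proved; no
definitions (the profile is packaged as an existence statement), no named facts.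

## References

* J.-P. Sha, *`p`-convex Riemannian manifolds*, Invent. Math. 83 (1986), 437–447, Thm. 1.
  [Sha1986]
* J. Milnor, *Morse theory*, Ann. of Math. Studies 51 (1963), §§2–3. [Milnor1963]
-/

noncomputable section

open scoped ContDiff Topology
open Set Filter MeasureTheory intervalIntegral

namespace Literature.Geometry.Riemannian

/-- **The one-variable profile of the boundary-adapted height function.**  For every `σ > 0`
there is a smooth `λ : ℝ → ℝ` with `λ(0) = 0`, `λ'(0) = 1`, `λ < 0` on `(-∞, 0)`, `λ > 0` and
`λ' ≥ 0` on `(0, ∞)`, `λ' = 0` on `[σ, ∞)`, and, on `(0, ∞)`,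

  `λ λ' ≤ s (2 λ'² - λ λ'')`,

i.e. `(μ'² - μ'') / μ' ≥ 1 / s` for `μ = log λ` wherever `μ' > 0`.  Construction: `λ = s` on
`(-∞, σ/2]` and `λ = exp μ` on `(0, ∞)` with `μ(s) = log (σ/2) + ∫_{σ/2}^{s} φ(v)/v dv`,
`φ(v) = 1 - S((v - σ/2)/(σ/2))` (`S` Mathlib's `Real.smoothTransition`), a smooth plateau
decreasing from `1` to `0` on `[σ/2, σ]`; the two definitions agree on `(0, σ/2]`
(`∫ dv/v = log`), `λ' = λ φ / s`, `λ'' = λ (φ² + s φ' - φ) / s²`, and the inequality reduces to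
`φ² - s φ' ≥ 0`, i.e. `φ' ≤ 0`.  Role (module docstring): with `G = 1 + λ(-F) · (⟪a, ·⟫ - c₁)`
on `Ω = {F ≤ 0}`, `λ(0) = 0 < λ'(0)` makes `1` a regular top level with `{G ≤ 1} = Ω`,
`λ' = 0` beyond depth `σ` confines the critical points to the collar `{0 < -F < σ}`, and at a
critical point of depth `s` the Hessian is `D²G = w λ' · D²F + w (2λ'²/λ - λ'') · DF ⊗ DF`
(`w = c₁ - ⟪a, ·⟫ > 0`), whose ratio `N/κ = (2λ'²/λ - λ'')/λ' ≥ 1/s ≥ 1/σ` is as large as the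
index and nondegeneracy criteria of `BoundaryAdaptedHessian.lean` require once `σ` is small.
[folklore] -/
theorem exists_boundaryProfile {σ : ℝ} (hσ : 0 < σ) :
    ∃ lam : ℝ → ℝ, ContDiff ℝ ∞ lam ∧ lam 0 = 0 ∧ deriv lam 0 = 1 ∧
      (∀ s, s < 0 → lam s < 0) ∧ (∀ s, 0 < s → 0 < lam s) ∧ (∀ s, 0 < s → 0 ≤ deriv lam s) ∧
      (∀ s, σ ≤ s → deriv lam s = 0) ∧
      (∀ s, 0 < s → lam s * deriv lam s ≤
        s * (2 * deriv lam s ^ 2 - lam s * deriv (deriv lam) s)) := by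
  set s₁ : ℝ := σ / 2 with hs₁
  have hs₁0 : 0 < s₁ := by positivity
  have hσs : σ = 2 * s₁ := by rw [hs₁]; ring
  -- the decreasing plateau `φ`: `1` on `(-∞, s₁]`, `0` on `[σ, ∞)`
  set φ : ℝ → ℝ := fun v => 1 - Real.smoothTransition ((v - s₁) / s₁) with hφ
  have hφ_smooth : ContDiff ℝ ∞ φ :=
    contDiff_const.sub
      (Real.smoothTransition.contDiff.comp ((contDiff_id.sub contDiff_const).div_const _))
  have hφ_diff : Differentiable ℝ φ := hφ_smooth.differentiable (by simp)
  have hφ_one : ∀ v, v ≤ s₁ → φ v = 1 := fun v hv => by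
    have : (v - s₁) / s₁ ≤ 0 := div_nonpos_of_nonpos_of_nonneg (by linarith) hs₁0.le
    simp [hφ, Real.smoothTransition.zero_of_nonpos this]
  have hφ_zero : ∀ v, σ ≤ v → φ v = 0 := fun v hv => by
    have : 1 ≤ (v - s₁) / s₁ := by
      rw [le_div_iff₀ hs₁0]; linarith
    simp [hφ, Real.smoothTransition.one_of_one_le this]
  have hφ_nonneg : ∀ v, 0 ≤ φ v := fun v =>
    sub_nonneg.2 (Real.smoothTransition.le_one _)
  have hφ_anti : Antitone φ := fun a b hab => by
    simp only [hφ]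
    have : (a - s₁) / s₁ ≤ (b - s₁) / s₁ := div_le_div_of_nonneg_right (by linarith) hs₁0.le
    linarith [Real.smoothTransition.monotone this]
  have hφ_deriv : ∀ v, deriv φ v ≤ 0 := fun v => hφ_anti.deriv_nonpos
  -- `ψ = φ / id`, the logarithmic derivative of the profile on `(0, ∞)`
  set ψ : ℝ → ℝ := fun v => φ v / v with hψ
  have hψ_smooth : ContDiffOn ℝ ∞ ψ (Ioi 0) :=
    hφ_smooth.contDiffOn.div contDiffOn_id fun v hv => ne_of_gt hv
  have hψ_cont : ContinuousOn ψ (Ioi 0) := hψ_smooth.continuousOn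
  have hψ_deriv : ∀ v, 0 < v → HasDerivAt ψ ((deriv φ v * v - φ v) / v ^ 2) v := fun v hv => by
    have h1 := (hφ_diff v).hasDerivAt
    have h2 : HasDerivAt (fun y => φ y / y) ((deriv φ v * v - φ v * 1) / v ^ 2) v :=
      h1.div (hasDerivAt_id v) hv.ne'
    rw [hψ]
    simpa using h2
  -- `μ = log` continued by `∫ ψ`
  set μ : ℝ → ℝ := fun s => Real.log s₁ + ∫ v in s₁..s, ψ v with hμ
  have hμ_deriv : ∀ s, 0 < s → HasDerivAt μ (ψ s) s := by
    intro s hs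
    have hsub : uIcc s₁ s ⊆ Ioi 0 := fun v hv => by
      rcases le_total s₁ s with h | h
      · rw [uIcc_of_le h] at hv; exact lt_of_lt_of_le hs₁0 hv.1
      · rw [uIcc_of_ge h] at hv; exact lt_of_lt_of_le hs hv.1
    have hint : IntervalIntegrable ψ volume s₁ s := (hψ_cont.mono hsub).intervalIntegrable
    have hmeas : StronglyMeasurableAtFilter ψ (𝓝 s) volume :=
      hψ_cont.stronglyMeasurableAtFilter isOpen_Ioi s hs
    have hcont : ContinuousAt ψ s := hψ_cont.continuousAt (Ioi_mem_nhds hs)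
    have h := intervalIntegral.integral_hasDerivAt_right hint hmeas hcont
    exact h.const_add _
  have hμ_diffOn : DifferentiableOn ℝ μ (Ioi 0) := fun s hs =>
    (hμ_deriv s hs).differentiableAt.differentiableWithinAt
  have hμ_derivEq : ∀ s ∈ Ioi (0 : ℝ), deriv μ s = ψ s := fun s hs => (hμ_deriv s hs).deriv
  have hμ_smooth : ContDiffOn ℝ ∞ μ (Ioi 0) := by
    rw [contDiffOn_infty_iff_deriv_of_isOpen isOpen_Ioi]
    exact ⟨hμ_diffOn, hψ_smooth.congr hμ_derivEq⟩
  have hμ_log : ∀ s, 0 < s → s ≤ s₁ → μ s = Real.log s := by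
    intro s hs hss
    have h1 : ∫ v in s₁..s, ψ v = ∫ v in s₁..s, v⁻¹ := by
      refine intervalIntegral.integral_congr fun v hv => ?_
      rw [uIcc_of_ge hss] at hv
      simp [hψ, hφ_one v hv.2]
    simp only [hμ]
    rw [h1, integral_inv_of_pos hs₁0 hs, Real.log_div hs.ne' hs₁0.ne']
    ring
  -- the profile
  set lam : ℝ → ℝ := fun s => if s ≤ s₁ then s else Real.exp (μ s) with hlam
  have hlam_le : ∀ s, s ≤ s₁ → lam s = s := fun s hs => by simp [hlam, hs]
  have hlam_pos_eq : ∀ s, 0 < s → lam s = Real.exp (μ s) := fun s hs => by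
    by_cases h : s ≤ s₁
    · rw [hlam_le s h, hμ_log s hs h, Real.exp_log hs]
    · simp [hlam, h]
  have hexpμ : ContDiffOn ℝ ∞ (fun s => Real.exp (μ s)) (Ioi 0) := Real.contDiff_exp.comp_contDiffOn hμ_smooth
  have hlam_eventually_pos : ∀ s, 0 < s → lam =ᶠ[𝓝 s] fun s => Real.exp (μ s) := fun s hs => by
    filter_upwards [Ioi_mem_nhds hs] with v hv using hlam_pos_eq v hv
  have hlam_eventually_neg : ∀ s, s < s₁ → lam =ᶠ[𝓝 s] fun s => s := fun s hs => by
    filter_upwards [Iio_mem_nhds hs] with v hv using hlam_le v hv.le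
  have hlam_smooth : ContDiff ℝ ∞ lam := by
    rw [contDiff_iff_contDiffAt]
    intro s
    rcases lt_or_ge s s₁ with h | h
    · exact contDiffAt_id.congr_of_eventuallyEq (hlam_eventually_neg s h)
    · have hs : 0 < s := lt_of_lt_of_le hs₁0 h
      exact ((hexpμ.contDiffAt (Ioi_mem_nhds hs))).congr_of_eventuallyEq
        (hlam_eventually_pos s hs)
  -- first derivative on `(0, ∞)`
  have hlam_hasDeriv : ∀ s, 0 < s → HasDerivAt lam (lam s * ψ s) s := by
    intro s hs
    have h1 : HasDerivAt (fun s => Real.exp (μ s)) (Real.exp (μ s) * ψ s) s :=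
      (hμ_deriv s hs).exp
    rw [hlam_pos_eq s hs]
    exact h1.congr_of_eventuallyEq (hlam_eventually_pos s hs)
  have hlam_deriv : ∀ s, 0 < s → deriv lam s = lam s * ψ s := fun s hs =>
    (hlam_hasDeriv s hs).deriv
  have hlam_pos : ∀ s, 0 < s → 0 < lam s := fun s hs => by
    rw [hlam_pos_eq s hs]; exact Real.exp_pos _
  -- second derivative on `(0, ∞)`
  have hlam_deriv2 : ∀ s, 0 < s → deriv (deriv lam) s =
      lam s * ψ s * ψ s + lam s * ((deriv φ s * s - φ s) / s ^ 2) := by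
    intro s hs
    have h1 : deriv lam =ᶠ[𝓝 s] fun v => lam v * ψ v := by
      filter_upwards [Ioi_mem_nhds hs] with v hv using hlam_deriv v hv
    rw [h1.deriv_eq]
    exact ((hlam_hasDeriv s hs).mul (hψ_deriv s hs)).deriv
  refine ⟨lam, hlam_smooth, ?_, ?_, ?_, hlam_pos, ?_, ?_, ?_⟩
  · exact (hlam_le 0 hs₁0.le)
  · have h1 : deriv lam 0 = deriv (fun s : ℝ => s) 0 := (hlam_eventually_neg 0 hs₁0).deriv_eq
    rw [h1, deriv_id'']
  · intro s hs
    rw [hlam_le s (by linarith)]; exact hs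
  · intro s hs
    rw [hlam_deriv s hs, hψ]
    exact mul_nonneg (hlam_pos s hs).le (div_nonneg (hφ_nonneg s) hs.le)
  · intro s hs
    have hs0 : 0 < s := lt_of_lt_of_le hσ hs
    rw [hlam_deriv s hs0, hψ]
    simp [hφ_zero s hs]
  · intro s hs
    rw [hlam_deriv s hs, hlam_deriv2 s hs]
    have hl := hlam_pos s hs
    have hd := hφ_deriv s
    have hφ0 := hφ_nonneg s
    simp only [hψ]
    have key : s * (2 * (lam s * (φ s / s)) ^ 2 -
        lam s * (lam s * (φ s / s) * (φ s / s) + lam s * ((deriv φ s * s - φ s) / s ^ 2))) -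
        lam s * (lam s * (φ s / s)) = lam s ^ 2 / s * (φ s ^ 2 - deriv φ s * s) := by
      field_simp
      ring
    have key2 : 0 ≤ lam s ^ 2 / s * (φ s ^ 2 - deriv φ s * s) := by
      apply mul_nonneg (by positivity)
      nlinarith
    linarith

end Literature.Geometry.Riemannian
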